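import Summits.ResolutionOfSingularities.ResolutionOfSingularities.Theorems.WildConesCampaignW46HypersurfacesCharTwoTangentLeaf

/-!
# [OURS · L1 W4.6, rung (ii) at p = 2, EVERY dimension n] ISOLATEDNESS TRANSFER — the surface
# leaf: an ISOLATED plane germ with a tangent cubic (`h₂ ≤ 2`) has ISOLATED double successors
# (finiteness of the Milnor algebra passes to the strict transform; chart `x`, any slope;
# hypersurface double points `z² = a`, every field of characteristic 2)

HONEST FRAMING. Everything here is OURS: lemmas about route WildCones' own TYPED point-blow-up
dynamics in its formal dress (`Theorems/WildConesClassicalRegimesStubMuDropCharTwoOrdP*.lean`: the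
blow-up relation `X_0² G = a∘Φ_{0,τ}` between the cleaned series `a ∈ κ⟦x,y⟧` of a surface double
point without `xy`-term and the series `G` of its successor; the shear `shear_transfer`, the strict
transforms `exists_strict_transform` of the polars `f = ∂ₓa`, `g = ∂_y a`, the gradient
`∂_yG = x·x^{m_g-2}g'`, `∂ₓG = x^{m_f-2}f' + y·x^{m_g-2}g'` of the tree's `surface_drop`) and this
seat's invariant `jetThreeColength` (p511581, p512443). Nothing here is a statement of H. Hironaka's
manuscript [Hironaka2017] and nothing of it is used; no FACT-LIST premise. AI review is weaker than
expert review. Cell res-hironaka (LADDER-RESOLUTION rung L, D-0089), slot W4.6, seat res-L1-s46-pv-4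
(gen 4); host route `WildCones`, crux `ClassicalRegimes` (stmt-ResolutionOfSingularities-16884,
proved); `--supports` that item as a helper.

WHAT IS HERE (third file of the gen-4 package «the case `e = 2`»). The tree's surface leaf
`surface_drop` ASSUMES the successor isolated and proves the Milnor drop (Max Noether). Here the
missing half: **`surface_isol_transfer`** — if `a` (order `≥ 2`, no `xy`-term) has FINITE Milnor
algebra and `jetThreeColength a ≤ 5` (not both polars in `𝔪³`: a tangent cubic exists), then the
Milnor algebra of `G` is FINITE. Proof, all in ideal arithmetic (no unique factorisation used):
(1) `x^N ∈ (f, g)` (finite colength, `exists_forall_X_pow_mem_of_finite_quotient`) is pushed through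
the blow-up: `x^N ∈ (x^{m_f} f', x^{m_g} g') ⊆ (f', g')`; with `(x, f')` of finite colength
(`colength_X_eq_order`) this gives `𝔪^M ⊆ (f', g')` (`pow_le_sup_pow_of_le_sup`); (2) the restriction
of `P = ∂ₓG` to the exceptional line is `f₂(1,y) + y·g₂(1,y) ≠ 0` when `min(m_f, m_g) = 2` (the even
coefficients come from `f'`, the odd ones from `g'`; the `xy`-coefficients of the polars vanish in
characteristic two), so `(P, x)` has finite colength; (3) `(P, H₁) = (f', x^{m_g-2} g')` or
`(x^{m_f-2} f', g')` contains `(x, f')^e (f', g')`; (4) `(P, x)(P, H₁) ⊆ (P, xH₁) = (∂G)`.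
The transport to either chart, the descent along the hyperbolic pairs and the state-level dichotomy
are in `…HypersurfacesCharTwoIsolTransfer.lean`.

References: E. Casas-Alvero, Singularities of Plane Curves, §3 (strict transforms of polars; context
only); G.-M. Greuel, G. Pfister [GreuelPfister2026] (context); H. Hironaka, ms. 2017-03-23
[Hironaka2017] — ROLE only (Th. 16.6 p.84, Th. 16.13 p.87), under adjudication, never as fact.
-/

noncomputable section

-- single-problem summit: the doubled namespace component `ResolutionOfSingularities` is forced
set_option linter.dupNamespace false

open scoped BigOperators Classical

open MvPowerSeries IsLocalRing

open Literature.AlgebraicGeometry.Resolution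

namespace Summit.ResolutionOfSingularities.ResolutionOfSingularities.Theorems

namespace CampaignW46.HypersurfacesCharTwo

open WildCones WildCones.MuDropCharTwoOrdP ThreefoldsCharTwo

variable {κ : Type} [Field κ]

/-! ## Ideal arithmetic -/

/-- `M ≤ J + K` gives `M^k ≤ J + K^k` (commutative ring). [folklore] -/
theorem pow_le_sup_pow_of_le_sup {A : Type} [CommRing A] {M J K : Ideal A} (h : M ≤ J ⊔ K) :
    ∀ k : ℕ, M ^ k ≤ J ⊔ K ^ k
  | 0 => by rw [pow_zero, pow_zero, Ideal.one_eq_top, sup_top_eq]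
  | k + 1 => by
    rw [pow_succ, pow_succ]
    calc M ^ k * M ≤ (J ⊔ K ^ k) * (J ⊔ K) := Ideal.mul_mono (pow_le_sup_pow_of_le_sup h k) h
      _ ≤ J ⊔ K ^ k * K := by
        rw [Ideal.sup_mul, Ideal.mul_sup, Ideal.mul_sup]
        exact sup_le (sup_le (Ideal.mul_le_right.trans le_sup_left)
          (Ideal.mul_le_right.trans le_sup_left))
          (sup_le (Ideal.mul_le_left.trans le_sup_left) le_sup_right)

/-- `(x, f)^e · (f, g) ≤ (f, x^e g)` (commutative ring). [folklore] -/
theorem span_pair_pow_mul_span_pair_le {A : Type} [CommRing A] (x f g : A) :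
    ∀ e : ℕ, Ideal.span {x, f} ^ e * Ideal.span {f, g} ≤ Ideal.span {f, x ^ e * g}
  | 0 => by rw [pow_zero, one_mul, pow_zero, one_mul]
  | e + 1 => by
    rw [pow_succ', mul_assoc]
    refine (Ideal.mul_mono_right (span_pair_pow_mul_span_pair_le x f g e)).trans ?_
    rw [Ideal.span_pair_mul_span_pair, Ideal.span_le]
    have hf : f ∈ Ideal.span {f, x ^ (e + 1) * g} := Ideal.subset_span (by simp)
    have hg : x ^ (e + 1) * g ∈ Ideal.span {f, x ^ (e + 1) * g} := Ideal.subset_span (by simp)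
    intro z hz
    simp only [Set.mem_insert_iff, Set.mem_singleton_iff] at hz
    rcases hz with rfl | rfl | rfl | rfl
    · exact Ideal.mul_mem_left _ _ hf
    · rw [show x * (x ^ e * g) = x ^ (e + 1) * g by ring]
      exact hg
    · exact Ideal.mul_mem_left _ _ hf
    · exact Ideal.mul_mem_right _ _ hf

/-- `(x, P) · (P, H) ≤ (P, x H)` (commutative ring). [folklore] -/
theorem span_pair_mul_span_pair_le {A : Type} [CommRing A] (x P H : A) :
    Ideal.span {x, P} * Ideal.span {P, H} ≤ Ideal.span {P, x * H} := by
  rw [Ideal.span_pair_mul_span_pair, Ideal.span_le]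
  have hP : P ∈ Ideal.span {P, x * H} := Ideal.subset_span (by simp)
  have hH : x * H ∈ Ideal.span {P, x * H} := Ideal.subset_span (by simp)
  intro z hz
  simp only [Set.mem_insert_iff, Set.mem_singleton_iff] at hz
  rcases hz with rfl | rfl | rfl | rfl
  · exact Ideal.mul_mem_left _ _ hP
  · exact hH
  · exact Ideal.mul_mem_left _ _ hP
  · exact Ideal.mul_mem_right _ _ hP

/-- A finite-colength ideal of `κ⟦X⟧` contains a power of `𝔪` (also when it is `⊤`). [folklore] -/
theorem exists_pow_le_of_finite {n : ℕ} {I : Ideal (MvPowerSeries (Fin n) κ)}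
    (hI : Module.Finite κ (MvPowerSeries (Fin n) κ ⧸ I)) :
    ∃ r : ℕ, maximalIdeal (MvPowerSeries (Fin n) κ) ^ r ≤ I := by
  by_cases hI' : I = ⊤
  · exact ⟨0, by rw [hI']; exact le_top⟩
  · exact exists_maximalIdeal_pow_le hI hI'

/-! ## Coefficients on the exceptional line `x = 0` -/

/-- Some axis coefficient of `h` is non-zero when `h(0, y) ≠ 0`. [folklore] -/
theorem exists_coeff_axis_ne_zero {h : MvPowerSeries (Fin 2) κ}
    (hh : killCompl (⟨fun _ => (1 : Fin 2), fun a b _ => Subsingleton.elim a b⟩ : Fin 1 ↪ Fin 2) h ≠ 0) :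
    ∃ k, coeff (Finsupp.single 1 k) h ≠ 0 := by
  by_contra h0
  push Not at h0
  apply hh
  ext d
  have hd : d = Finsupp.single 0 (d 0) := Finsupp.ext fun s => by fin_cases s; simp
  rw [hd, coeff_killCompl_axis, h0, map_zero]

/-- `h(0, y) ≠ 0` when some axis coefficient of `h` is non-zero. [folklore] -/
theorem killCompl_ne_zero_of_coeff_axis {h : MvPowerSeries (Fin 2) κ} {k : ℕ}
    (hk : coeff (Finsupp.single 1 k) h ≠ 0) :
    killCompl (⟨fun _ => (1 : Fin 2), fun a b _ => Subsingleton.elim a b⟩ : Fin 1 ↪ Fin 2) h ≠ 0 := by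
  intro h0
  have := congrArg (coeff (Finsupp.single 0 k)) h0
  rw [coeff_killCompl_axis, map_zero] at this
  exact hk this

/-- THE AXIS COEFFICIENTS OF A STRICT TRANSFORM: if `f∘B = x^m f'` along `B = (x, xy)` then
`[y^k] f' = [x^{m-k} y^k] f` for `k ≤ m` and `0` for `k > m` (`f'(0, y) = f_m(1, y)`). [folklore] -/
theorem coeff_axis_strict {f f' : MvPowerSeries (Fin 2) κ} {m : ℕ}
    (hff' : subst (![X 0, X 0 * X 1] : Fin 2 → MvPowerSeries (Fin 2) κ) f = X 0 ^ m * f') (k : ℕ) :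
    coeff (Finsupp.single 1 k) f' =
      if k ≤ m then coeff (Finsupp.single 0 (m - k) + Finsupp.single 1 k) f else 0 := by
  have h1 : coeff (Finsupp.single 0 m + Finsupp.single 1 k) (X 0 ^ m * f') =
      coeff (Finsupp.single 1 k) f' := by
    rw [X_pow_eq, coeff_monomial_mul, if_pos (by simp), one_mul, add_tsub_cancel_left]
  rw [← h1, ← hff', coeff_subst_blow', (finTwo_pair_apply _ _).1, (finTwo_pair_apply _ _).2]

/-- `[y^k] (x^{d+1} h) = 0`. [folklore] -/
theorem coeff_axis_X_pow_succ_mul (d k : ℕ) (h : MvPowerSeries (Fin 2) κ) :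
    coeff (Finsupp.single 1 k) (X 0 ^ (d + 1) * h) = 0 := by
  rw [X_pow_eq, coeff_monomial_mul, if_neg]
  rw [Finsupp.single_le_iff]
  simp

/-- `[y^{k+1}] (y h) = [y^k] h`. [folklore] -/
theorem coeff_axis_succ_X_mul (k : ℕ) (h : MvPowerSeries (Fin 2) κ) :
    coeff (Finsupp.single 1 (k + 1)) (X 1 * h) = coeff (Finsupp.single 1 k) h := by
  rw [show (Finsupp.single 1 (k + 1) : Fin 2 →₀ ℕ) = Finsupp.single 1 1 + Finsupp.single 1 k by
    rw [← Finsupp.single_add, add_comm], coeff_single_add_X_mul]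

/-- `[y^0] (y h) = 0`. [folklore] -/
theorem coeff_axis_zero_X_mul (h : MvPowerSeries (Fin 2) κ) :
    coeff (Finsupp.single 1 0) (X 1 * h) = 0 := by
  rw [Finsupp.single_zero, coeff_zero_eq_constantCoeff_apply, map_mul, constantCoeff_X, zero_mul]

/-! ## The surface leaf of the isolatedness transfer (chart `x`) -/

/-- [OURS · L1 W4.6] **ISOLATEDNESS TRANSFER, THE SURFACE LEAF** (characteristic two, chart `x`, any
slope `τ 1`): let `a ∈ κ⟦x,y⟧` have order `≥ 2`, no `xy`-term, FINITE Milnor algebra, and a tangent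
cubic (`jetThreeColength a ≤ 5`: not both polars in `𝔪³`); let `X_0² G = a∘Φ_{0,τ}`. Then the Milnor
algebra of `G` is FINITE — the double successor of an isolated surface double point with `h₂ ≤ 2` is
isolated. See the module docstring for the four steps. [folklore] -/
theorem surface_isol_transfer [CharP κ 2] (τ : Fin 2 → κ) {a G : MvPowerSeries (Fin 2) κ}
    (ha : 2 ≤ a.order) (hnopair : coeff (Finsupp.single 0 1 + Finsupp.single 1 1) a = 0)
    (hG : X 0 ^ 2 * G = subst (fun s => if s = (0 : Fin 2) then (X 0 : MvPowerSeries (Fin 2) κ)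
      else X 0 * (X s + C (τ s))) a)
    (hfa : Module.Finite κ (MvPowerSeries (Fin 2) κ ⧸
      Ideal.span (Set.range fun s => MvPowerSeries.pderiv s a)))
    (h5 : jetThreeColength a ≤ 5) :
    Module.Finite κ (MvPowerSeries (Fin 2) κ ⧸
      Ideal.span (Set.range fun s => MvPowerSeries.pderiv s G)) := by
  have range_fin_two : ∀ {α : Type} (h : Fin 2 → α), Set.range h = {h 0, h 1} := fun h => by
    ext x
    simp only [Set.mem_range, Set.mem_insert_iff, Set.mem_singleton_iff]
    constructor
    · rintro ⟨s, rfl⟩; fin_cases s <;> simp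
    · rintro (rfl | rfl) <;> exact ⟨_, rfl⟩
  set e : Fin 1 ↪ Fin 2 := ⟨fun _ => (1 : Fin 2), fun a b _ => Subsingleton.elim a b⟩ with he
  have h10 : (1 : Fin 2) ≠ 0 := by decide
  -- STEP 0: the shear to slope `0`
  rw [blowFam_two_eq_dirChart] at hG
  obtain ⟨a₁, ha₁, ha₁ord, ha₁pair, ⟨ε⟩⟩ := shear_transfer (τ 1) ha hnopair
  rw [ha₁] at hG
  have h5₁ : jetThreeColength a₁ ≤ 5 := by rw [← jetThreeColength_eq_of_equiv ε]; exact h5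
  haveI hfa₁ : Module.Finite κ (MvPowerSeries (Fin 2) κ ⧸
      Ideal.span (Set.range fun s => MvPowerSeries.pderiv s a₁)) := Module.Finite.equiv ε.toLinearEquiv
  clear hfa ha hnopair ha₁ h5
  rw [range_fin_two] at hfa₁
  rw [range_fin_two]
  have hG' : X 0 ^ 2 * G = subst (fun s => if s = (0 : Fin 2) then (X 0 : MvPowerSeries (Fin 2) κ)
      else X 0 * (X s + C ((0 : Fin 2 → κ) s))) a₁ := by rw [blowFam_two_zero]; exact hG
  have hrel1 : X 0 * MvPowerSeries.pderiv 1 G = subst ![X 0, X 0 * X 1] (MvPowerSeries.pderiv 1 a₁) := by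
    rw [← blowFam_two_zero]; exact X_mul_pderiv_strict_of_ne 0 0 (by decide) hG'
  have hrel0 : X 0 ^ 2 * MvPowerSeries.pderiv 0 G = subst ![X 0, X 0 * X 1] (MvPowerSeries.pderiv 0 a₁) +
      X 1 * subst ![X 0, X 0 * X 1] (MvPowerSeries.pderiv 1 a₁) := by
    have := X_sq_mul_pderiv_strict_self 0 0 hG'
    rw [blowFam_two_zero] at this
    rw [this, show Finset.univ.erase (0 : Fin 2) = {1} by decide, Finset.sum_singleton, ← hrel1]
    simp
  -- STEP 1: the polars of `a₁` and their strict transforms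
  set f := MvPowerSeries.pderiv 0 a₁ with hf
  set g := MvPowerSeries.pderiv 1 a₁ with hg
  have hf2 : 2 ≤ f.order := two_le_order_pderiv_two ha₁ord ha₁pair 0
  have hg2 : 2 ≤ g.order := two_le_order_pderiv_two ha₁ord ha₁pair 1
  have hfmem : f ∈ maximalIdeal (MvPowerSeries (Fin 2) κ) := by
    rw [Literature.RingTheory.MvPowerSeries.Jets.mem_maximalIdeal_iff_constantCoeff_eq_zero]
    exact ((FormalCoordChange.two_le_order_iff f).mp hf2).1
  have hgmem : g ∈ maximalIdeal (MvPowerSeries (Fin 2) κ) := by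
    rw [Literature.RingTheory.MvPowerSeries.Jets.mem_maximalIdeal_iff_constantCoeff_eq_zero]
    exact ((FormalCoordChange.two_le_order_iff g).mp hg2).1
  have hf0 : f ≠ 0 := by
    intro h0
    rw [h0, Ideal.span_insert_zero] at hfa₁
    exact not_finite_quot_span {g} (by simpa using hgmem) (by simp) (by rw [Finset.coe_singleton]; exact hfa₁)
  have hg0 : g ≠ 0 := by
    intro h0
    rw [h0, Ideal.span_pair_zero] at hfa₁
    exact not_finite_quot_span {f} (by simpa using hfmem) (by simp) (by rw [Finset.coe_singleton]; exact hfa₁)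
  set mf := f.order.toNat with hmf
  set mg := g.order.toNat with hmg
  have hordf : (mf : ℕ∞) = f.order := ne_zero_iff_order_finite.mp hf0
  have hordg : (mg : ℕ∞) = g.order := ne_zero_iff_order_finite.mp hg0
  have hmf2 : 2 ≤ mf := by have := hf2; rw [← hordf] at this; exact_mod_cast this
  have hmg2 : 2 ≤ mg := by have := hg2; rw [← hordg] at this; exact_mod_cast this
  obtain ⟨f', hff', hKf, -⟩ := exists_strict_transform hf0
  obtain ⟨g', hgg', hKg, -⟩ := exists_strict_transform hg0
  have hff'' : subst ![X 0, X 0 * X 1] f = X 0 ^ mf * f' := hff'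
  have hgg'' : subst ![X 0, X 0 * X 1] g = X 0 ^ mg * g' := hgg'
  have hpf : (X 0 : MvPowerSeries (Fin 2) κ) ^ mf = X 0 ^ 2 * X 0 ^ (mf - 2) := by
    rw [← pow_add]; congr 1; omega
  have hpg : (X 0 : MvPowerSeries (Fin 2) κ) ^ mg = X 0 ^ 2 * X 0 ^ (mg - 2) := by
    rw [← pow_add]; congr 1; omega
  -- `∂₁ G = x^{mg-1} g'`, `∂₀ G = x^{mf-2} f' + y x^{mg-2} g'`
  set H₀ := X 0 ^ (mf - 2) * f' with hH₀
  set H₁ := X 0 ^ (mg - 2) * g' with hH₁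
  have hd1 : MvPowerSeries.pderiv 1 G = X 0 * H₁ := by
    apply MvPowerSeries.X_mul_cancel (i := (0 : Fin 2))
    rw [hrel1, hgg'', hH₁, hpg]; ring
  have hd0 : MvPowerSeries.pderiv 0 G = H₀ + X 1 * H₁ := by
    have h2 : X 0 ^ 2 * MvPowerSeries.pderiv 0 G = X 0 ^ 2 * (H₀ + X 1 * H₁) := by
      rw [hrel0, hff'', hgg'', hH₀, hH₁, hpf, hpg]; ring
    rw [pow_two, mul_assoc, mul_assoc] at h2
    exact MvPowerSeries.X_mul_cancel (MvPowerSeries.X_mul_cancel h2)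
  rw [hd0, hd1]
  set P := H₀ + X 1 * H₁ with hP
  -- the `xy`-coefficients of the polars vanish (characteristic two)
  have hf11 : coeff (Finsupp.single 0 1 + Finsupp.single 1 1) f = 0 := coeff_pair_pderiv_eq_zero h10 0 a₁
  have hg11 : coeff (Finsupp.single 0 1 + Finsupp.single 1 1) g = 0 := coeff_pair_pderiv_eq_zero h10 1 a₁
  -- STEP 2: not both orders `≥ 3` (a tangent cubic exists)
  have hcase : mf = 2 ∨ mg = 2 := by
    by_contra hc
    push Not at hc
    have h3 : ∀ s, MvPowerSeries.pderiv s a₁ ∈ maximalIdeal (MvPowerSeries (Fin 2) κ) ^ 3 := by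
      intro s
      rcases finTwo_eq_or h10 s with rfl | rfl
      · exact Literature.RingTheory.MvPowerSeries.Jets.mem_maximalIdeal_pow_of_le_order
          (by rw [← hf, ← hordf]; exact_mod_cast (show 3 ≤ mf by omega))
      · exact Literature.RingTheory.MvPowerSeries.Jets.mem_maximalIdeal_pow_of_le_order
          (by rw [← hg, ← hordg]; exact_mod_cast (show 3 ≤ mg by omega))
    have := (jetThreeColength_eq_six_iff a₁).mpr h3
    omega
  -- STEP 3: `x^N ∈ (f', g')` and `𝔪^{M₁} ≤ (f', g')`
  obtain ⟨N, hN⟩ :=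
    Literature.RingTheory.MvPowerSeries.Jets.exists_forall_X_pow_mem_of_finite_quotient (Ideal.span {f, g})
  have hXN : (X 0 : MvPowerSeries (Fin 2) κ) ^ N ∈ Ideal.span {f', g'} := by
    obtain ⟨u, v, huv⟩ := Ideal.mem_span_pair.mp (hN 0)
    have hB := PlaneGerm.hasSubst_blow (k := κ)
    have h := congrArg (subst (![X 0, X 0 * X 1] : Fin 2 → MvPowerSeries (Fin 2) κ)) huv
    rw [subst_add hB, subst_mul hB, subst_mul hB, hff'', hgg'', subst_pow hB, subst_X hB] at h
    have h0 : (![X 0, X 0 * X 1] : Fin 2 → MvPowerSeries (Fin 2) κ) 0 = X 0 := rfl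
    rw [h0] at h
    rw [← h]
    exact Ideal.mem_span_pair.mpr ⟨subst ![X 0, X 0 * X 1] u * X 0 ^ mf,
      subst ![X 0, X 0 * X 1] v * X 0 ^ mg, by ring⟩
  obtain ⟨Lf, hLf⟩ := exists_pow_le_of_finite (colength_X_eq_order hKf).1
  obtain ⟨Lg, hLg⟩ := exists_pow_le_of_finite (colength_X_eq_order hKg).1
  have hJ : maximalIdeal (MvPowerSeries (Fin 2) κ) ^ (Lf * N) ≤ Ideal.span {f', g'} := by
    have h1 : maximalIdeal (MvPowerSeries (Fin 2) κ) ^ Lf ≤ Ideal.span {f', g'} ⊔ Ideal.span {(X 0 : MvPowerSeries (Fin 2) κ)} := by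
      refine hLf.trans ?_
      rw [Ideal.span_insert, sup_comm]
      exact sup_le_sup_right (Ideal.span_mono (by simp)) _
    have h2 := pow_le_sup_pow_of_le_sup h1 N
    rw [← pow_mul, Ideal.span_singleton_pow,
      sup_eq_left.mpr ((Ideal.span_singleton_le_iff_mem _).mpr hXN)] at h2
    exact h2
  -- STEP 4: `P(0, y) ≠ 0`, so `(x, P)` has finite colength
  have hKP : killCompl e P ≠ 0 := by
    by_cases hmf2' : mf = 2
    · -- `H₀ = f'`; the even axis coefficients of `P` are those of `f'`
      have hH₀' : H₀ = f' := by rw [hH₀, hmf2', Nat.sub_self, pow_zero, one_mul]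
      obtain ⟨k, hk⟩ := exists_coeff_axis_ne_zero hKf
      have hk' := hk
      rw [coeff_axis_strict hff'' k, hmf2'] at hk'
      have hk2 : k ≤ 2 := by
        by_contra hk2
        exact hk' (by rw [if_neg hk2])
      have hk1 : k ≠ 1 := by
        rintro rfl
        rw [if_pos (by norm_num), show (2 : ℕ) - 1 = 1 from rfl] at hk'
        exact hk' hf11
      -- `[y] H₁ = 0`
      have hH₁1 : coeff (Finsupp.single 1 1) H₁ = 0 := by
        rw [hH₁]
        by_cases hmg2' : mg = 2
        · rw [hmg2', Nat.sub_self, pow_zero, one_mul, coeff_axis_strict hgg'' 1, hmg2',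
            if_pos (by norm_num), show (2 : ℕ) - 1 = 1 from rfl, hg11]
        · rw [show mg - 2 = (mg - 3) + 1 by omega, coeff_axis_X_pow_succ_mul]
      have hk02 : k = 0 ∨ k = 2 := by omega
      rcases hk02 with rfl | rfl
      · refine killCompl_ne_zero_of_coeff_axis (k := 0) ?_
        rw [hP, map_add, hH₀', coeff_axis_zero_X_mul, add_zero]
        exact hk
      · refine killCompl_ne_zero_of_coeff_axis (k := 2) ?_
        rw [hP, map_add, hH₀', coeff_axis_succ_X_mul, hH₁1, add_zero]
        exact hk
    · -- `mg = 2`, `mf ≥ 3`: `P(0, y) = y g'(0, y)`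
      have hmg2' : mg = 2 := hcase.resolve_left hmf2'
      have hH₁' : H₁ = g' := by rw [hH₁, hmg2', Nat.sub_self, pow_zero, one_mul]
      obtain ⟨k, hk⟩ := exists_coeff_axis_ne_zero hKg
      refine killCompl_ne_zero_of_coeff_axis (k := k + 1) ?_
      rw [hP, map_add, hH₁', coeff_axis_succ_X_mul, hH₀, show mf - 2 = (mf - 3) + 1 by omega,
        coeff_axis_X_pow_succ_mul, zero_add]
      exact hk
  obtain ⟨M₂, hM₂⟩ := exists_pow_le_of_finite (colength_X_eq_order hKP).1
  -- STEP 5: `(P, H₁)` contains a power of `𝔪`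
  have hM₃ : ∃ M₃, maximalIdeal (MvPowerSeries (Fin 2) κ) ^ M₃ ≤ Ideal.span {P, H₁} := by
    by_cases hmf2' : mf = 2
    · have hH₀' : H₀ = f' := by rw [hH₀, hmf2', Nat.sub_self, pow_zero, one_mul]
      refine ⟨Lf * (mg - 2) + Lf * N, ?_⟩
      rw [hP, Ideal.span_pair_add_mul_right, hH₀', hH₁, pow_add, pow_mul]
      exact (Ideal.mul_mono (Ideal.pow_right_mono hLf _) hJ).trans
        (span_pair_pow_mul_span_pair_le _ _ _ _)
    · have hmg2' : mg = 2 := hcase.resolve_left hmf2'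
      have hH₁' : H₁ = g' := by rw [hH₁, hmg2', Nat.sub_self, pow_zero, one_mul]
      refine ⟨Lg * (mf - 2) + Lf * N, ?_⟩
      rw [hP, Ideal.span_pair_add_mul_right, hH₁', hH₀, pow_add, pow_mul, Ideal.span_pair_comm]
      refine (Ideal.mul_mono (Ideal.pow_right_mono hLg _) ?_).trans
        (span_pair_pow_mul_span_pair_le _ _ _ _)
      rw [Ideal.span_pair_comm]
      exact hJ
  obtain ⟨M₃, hM₃⟩ := hM₃
  -- STEP 6: `(x, P)(P, H₁) ≤ (P, x H₁)`
  have hle : maximalIdeal (MvPowerSeries (Fin 2) κ) ^ (M₂ + M₃) ≤ Ideal.span {P, X 0 * H₁} := by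
    rw [pow_add]
    exact (Ideal.mul_mono hM₂ hM₃).trans (span_pair_mul_span_pair_le _ _ _)
  exact finite_quot_mono hle
    (Literature.RingTheory.MvPowerSeries.Jets.finite_quotient_maximalIdeal_pow (M₂ + M₃))

end CampaignW46.HypersurfacesCharTwo

end Summit.ResolutionOfSingularities.ResolutionOfSingularities.Theorems

end
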